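import Summits.Ventures.CertifiedManyBodySolver.Downfold.EmeryFermiSurfaceRatioWindow
import Summits.Ventures.CertifiedManyBodySolver.Downfold.IntervalCalculus
import HarnessLib

/-!
# The one-band SCALE of the σ three-band (Emery) model at the Fermi surface, exactly: the velocity-matched
# nearest-neighbour hopping `t_eff(k) = fsT(ε_F)/∂_ε charCubic(k, ε_F)` is bracketed along the WHOLE Fermi
# surface by two closed-form numbers, and a kernel-checkable box rule encloses it on a parameter box

Venture CertifiedManyBodySolver, cell `pub/hubbard-downfold` (stage S1, HUMAN RULINGS D-0096/D-0098: the three-band →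
one-band reduction error is carried explicitly, never hidden), seat hubbard-downfold-mod-4 (technique B = band level);
namespace `Summit.Ventures.CertifiedManyBodySolver.Downfold.Emery`. Everything here is PROVED (exact algebra + rational
interval arithmetic decided by the kernel). WHAT THIS IS NOT: not a statement about any material (no literature number
lives here); `U = 0` band kinematics; the SHAPE side (`t′/t`, exact) is `EmeryFermiSurfaceShape`; this file is the SCALE side.

Setting (`EmeryFermiSurfaceShape`, `EmeryFermiSurfaceShapeBox` §2). At energy `ε` the secular cubic of the σ model is
`charCubic = cA − 4·fsD·(x + y) − 16·fsN·xy` in `x = sin²(kx/2)`, `y = sin²(ky/2)`, so the contour is a pure `t–t′`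
contour with `(t, t′) ∝ (fsT, −fsN)`, `fsT = fsD + 2fsN`. Linearising in the energy, the one-band model whose Fermi
surface AND Fermi velocity at the contour point `k` agree with the σ model has nearest-neighbour hopping
`scaleT(k) = fsT/∂_ε charCubic(k)` (`EmeryFermiSurfaceShapeBox.scaleT`), and ON the contour `∂_ε charCubic` is the AFFINE
function `dcharA + dcharB·(x + y)` (`dcharCubic_on_contour`).

* §1 CONTOUR GEOMETRY. The contour is the hyperbola `(4fsN·x + fsD)(4fsN·y + fsD) = fsK`, `fsK = fsN·cA + fsD²`
  (`contour_factor`, `contour_hyperbola`). In the cuprate regime (`fsD, fsN > 0`, `ε ≥ 0`) and inside the zone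
  `0 ≤ x, y ≤ 1` the sum `s = x + y` is bounded BELOW by the nodal value — certified WITHOUT square roots: any `σ` with
  `(fsD + 2fsN·σ)² ≤ fsK` is a lower bound (`le_sum_of_contour`, AM–GM) — and ABOVE by the zone-face value
  `s ≤ cA/(4fsD)` (`sum_le_of_contour_face0`, the `k_y = 0` face) and `s ≤ 1 + (cA − 4fsD)/(16fsN + 4fsD)`
  (`sum_le_of_contour_face1`, the `k_x = π` face; the smaller of the two is the exact maximum).
* §2 THE SCALE ALONG THE CONTOUR. `dcharCubic = dcharA + dcharB·s` (`dcharCubic_eq_affine`); hence between two Fermi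
  points the energy denominator differs by EXACTLY `dcharB·(s − s′)` (`dcharCubic_sub_eq`) and on the zone contour it lies
  between its values at `s = σlo` and `s = σhi` (`dcharCubic_mem_Icc_of_sum_mem`). This is the whole one-band-FORM content
  of the Fermi VELOCITY: a single `(t, t′)` reproduces the σ Fermi surface exactly and its velocity up to the factor
  `(dcharA + dcharB·σhi)/(dcharA + dcharB·σlo)` (`scaleT_le_mul_scaleT_of_check`).
* §3 THE BOX RULE. `scaleCheck` — rational interval arithmetic (the tree's `NonemptyInterval.mooreMul` / `divPos`,
  Moore 1966) over a parameter sub-box `Δ_pd × t_pd × t_pp × t_pp′` and an energy piece, deciding positivity of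
  `fsD, fsN, fsT, ∂_ε charCubic` and a window `[lo, hi] ∋ scaleT(k)` for EVERY zone contour point, plus an anisotropy
  factor `φ`; soundness `scaleT_mem_of_scaleCheck`, `scaleT_le_mul_scaleT_of_check`; the piecewise-in-energy wrapper
  `scaleCheckPieces` / `scaleT_mem_of_scaleCheckPieces` (uniform pieces `piecePt` of `EmeryFermiSurfaceRatioWindow`).
  Composed with the filling ↦ Fermi-energy certificates of `EmeryFermiFilling*` this words a typed 3BE one-body box ⇒
  the certified window of the object-E SCALE `t` at the box's own hole count (material files `EmeryFermiScale<Tag>`).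

Sources: three-band model [HybertsenSchluterChristensen1989, Eq. (1)]; energy-linearised downfolding and the `t, t′, t″`
language [AndersenEtAl1995, §6]; interval arithmetic [folklore] (Moore 1966, Ch. 2–3).
-/

noncomputable section

namespace Summit.Ventures.CertifiedManyBodySolver.Downfold.Emery

open Real Set NonemptyInterval

/-! ## §1 Contour geometry in the half-angle variables -/

/-- The contour constant `fsK = fsN·cA + fsD²` of the hyperbola form of the secular cubic. [folklore] -/
def fsK (Δ tpd tpp c ε : ℝ) : ℝ := fsN tpd tpp c ε * cA Δ ε + fsD Δ tpd c ε ^ 2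

/-- HYPERBOLA FORM of the secular cubic: `(4fsN·x + fsD)(4fsN·y + fsD) = fsK − fsN·charCubic` identically.
[folklore] -/
theorem contour_factor (Δ tpd tpp c x y ε : ℝ) :
    (4 * fsN tpd tpp c ε * x + fsD Δ tpd c ε) * (4 * fsN tpd tpp c ε * y + fsD Δ tpd c ε) =
      fsK Δ tpd tpp c ε - fsN tpd tpp c ε * charCubic Δ tpd tpp c x y ε := by
  rw [charCubic_bilinear, fsK]
  ring

/-- On a contour (`charCubic = 0`): `(4fsN·x + fsD)(4fsN·y + fsD) = fsK`. [folklore] -/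
theorem contour_hyperbola {Δ tpd tpp c x y ε : ℝ} (hP : charCubic Δ tpd tpp c x y ε = 0) :
    (4 * fsN tpd tpp c ε * x + fsD Δ tpd c ε) * (4 * fsN tpd tpp c ε * y + fsD Δ tpd c ε) = fsK Δ tpd tpp c ε := by
  rw [contour_factor, hP, mul_zero, sub_zero]

/-- `cA = ε(Δ + ε)² ≥ 0` for `ε ≥ 0`. [folklore] -/
theorem cA_nonneg {Δ ε : ℝ} (hε : 0 ≤ ε) : 0 ≤ cA Δ ε := by
  unfold cA; positivity

/-- `fsK > 0` in the cuprate regime (`fsD > 0`, `fsN > 0`, `ε ≥ 0`). [folklore] -/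
theorem fsK_pos {Δ tpd tpp c ε : ℝ} (hD : 0 < fsD Δ tpd c ε) (hN : 0 < fsN tpd tpp c ε) (hε : 0 ≤ ε) :
    0 < fsK Δ tpd tpp c ε := by
  unfold fsK
  have := mul_nonneg hN.le (cA_nonneg (Δ := Δ) hε)
  positivity

/-- AM–GM without square roots: `u, v ≥ 0`, `uv = K`, `m² ≤ K` ⇒ `2m ≤ u + v`. [folklore] -/
theorem two_mul_le_add_of_sq_le {u v m K : ℝ} (hu : 0 ≤ u) (hv : 0 ≤ v) (huv : u * v = K)
    (hmK : m ^ 2 ≤ K) : 2 * m ≤ u + v := by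
  by_contra h
  push Not at h
  have h1 : (u + v) ^ 2 < (2 * m) ^ 2 := by
    exact pow_lt_pow_left₀ h (by positivity) two_ne_zero
  nlinarith [sq_nonneg (u - v)]

/-- `L > 0`, `u, v ≥ L`, `uv = K` ⇒ `u + v ≤ L + K/L` (the sum on a hyperbola branch is largest at the ends).
[folklore] -/
theorem add_le_of_le_of_mul_eq {u v L K : ℝ} (hL : 0 < L) (hu : L ≤ u) (hv : L ≤ v) (huv : u * v = K) :
    u + v ≤ L + K / L := by
  have h : 0 ≤ (u - L) * (v - L) := mul_nonneg (by linarith) (by linarith)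
  have key : L + K / L - (u + v) = (u - L) * (v - L) / L := by
    rw [← huv]; field_simp; ring
  have : 0 ≤ L + K / L - (u + v) := by rw [key]; exact div_nonneg h hL.le
  linarith

/-- LOWER BOUND OF `s = x + y` ON A ZONE CONTOUR (nodal side), certified without square roots: if
`(fsD + 2fsN·σ)² ≤ fsK` then `σ ≤ x + y` at every contour point with `x, y ≥ 0` (`fsD, fsN > 0`). The exact
minimum `(√fsK − fsD)/(2fsN)` is attained at the node `x = y`. [folklore] -/
theorem le_sum_of_contour {Δ tpd tpp c x y ε σ : ℝ} (hN : 0 < fsN tpd tpp c ε) (hD : 0 < fsD Δ tpd c ε)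
    (hx : 0 ≤ x) (hy : 0 ≤ y) (hP : charCubic Δ tpd tpp c x y ε = 0)
    (hm : (fsD Δ tpd c ε + 2 * fsN tpd tpp c ε * σ) ^ 2 ≤ fsK Δ tpd tpp c ε) : σ ≤ x + y := by
  have huv := contour_hyperbola hP
  have hu : 0 ≤ 4 * fsN tpd tpp c ε * x + fsD Δ tpd c ε := by positivity
  have hv : 0 ≤ 4 * fsN tpd tpp c ε * y + fsD Δ tpd c ε := by positivity
  have h2 := two_mul_le_add_of_sq_le hu hv huv hm
  nlinarith

/-- UPPER BOUND OF `s = x + y` ON A ZONE CONTOUR from the face `y = 0` (`k_y = 0`): `x + y ≤ cA/(4fsD)` whenever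
`x, y ≥ 0` (`fsD, fsN > 0`); exact when the contour meets that face (Fermi level below the saddle). [folklore] -/
theorem sum_le_of_contour_face0 {Δ tpd tpp c x y ε : ℝ} (hN : 0 < fsN tpd tpp c ε) (hD : 0 < fsD Δ tpd c ε)
    (hx : 0 ≤ x) (hy : 0 ≤ y) (hP : charCubic Δ tpd tpp c x y ε = 0) :
    x + y ≤ cA Δ ε / (4 * fsD Δ tpd c ε) := by
  have huv := contour_hyperbola hP
  set N := fsN tpd tpp c ε with hNdef
  set D := fsD Δ tpd c ε with hDdef
  have hu : D ≤ 4 * N * x + D := by nlinarith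
  have hv : D ≤ 4 * N * y + D := by nlinarith
  have h := add_le_of_le_of_mul_eq hD hu hv huv
  -- h : (4Nx + D) + (4Ny + D) ≤ D + fsK/D ; multiply by D
  have h2 : (4 * N * (x + y) + 2 * D) * D ≤ D * D + fsK Δ tpd tpp c ε := by
    have := mul_le_mul_of_nonneg_right h hD.le
    have e1 : (4 * N * x + D + (4 * N * y + D)) * D = (4 * N * (x + y) + 2 * D) * D := by ring
    have e2 : (D + fsK Δ tpd tpp c ε / D) * D = D * D + fsK Δ tpd tpp c ε := by
      field_simp
    rwa [e1, e2] at this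
  have hKexp : fsK Δ tpd tpp c ε = N * cA Δ ε + D ^ 2 := by rw [fsK]
  rw [hKexp] at h2
  -- h2 ⇒ 4N(x+y)D ≤ N cA ; divide by N
  have h3 : N * (4 * (x + y) * D) ≤ N * cA Δ ε := by nlinarith
  have h4 : 4 * (x + y) * D ≤ cA Δ ε := le_of_mul_le_mul_left h3 hN
  rw [le_div_iff₀ (by positivity)]
  linarith

/-- UPPER BOUND OF `s = x + y` ON A ZONE CONTOUR from the face `x = 1` (`k_x = π`):
`x + y ≤ 1 + (cA − 4fsD)/(16fsN + 4fsD)` whenever `0 ≤ x, y ≤ 1` (`fsD, fsN > 0`, `ε ≥ 0`); exact when the contour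
meets that face (Fermi level above the saddle: hole-like surface about `(π, π)`). [folklore] -/
theorem sum_le_of_contour_face1 {Δ tpd tpp c x y ε : ℝ} (hN : 0 < fsN tpd tpp c ε) (hD : 0 < fsD Δ tpd c ε)
    (hε : 0 ≤ ε) (hx : 0 ≤ x) (hy : 0 ≤ y) (hx1 : x ≤ 1) (hy1 : y ≤ 1) (hP : charCubic Δ tpd tpp c x y ε = 0) :
    x + y ≤ 1 + (cA Δ ε - 4 * fsD Δ tpd c ε) / (16 * fsN tpd tpp c ε + 4 * fsD Δ tpd c ε) := by
  have huv := contour_hyperbola hP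
  have hK := fsK_pos hD hN hε
  set N := fsN tpd tpp c ε with hNdef
  set D := fsD Δ tpd c ε with hDdef
  set K := fsK Δ tpd tpp c ε with hKdef
  have hF : 0 < 4 * N + D := by positivity
  have hLpos : 0 < K / (4 * N + D) := div_pos hK hF
  have hule : 4 * N * x + D ≤ 4 * N + D := by nlinarith
  have hvle : 4 * N * y + D ≤ 4 * N + D := by nlinarith
  have hupos : 0 < 4 * N * x + D := by positivity
  have hvpos : 0 < 4 * N * y + D := by positivity
  have hu : K / (4 * N + D) ≤ 4 * N * x + D := by
    rw [div_le_iff₀ hF, ← huv]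
    exact mul_le_mul_of_nonneg_left hvle hupos.le
  have hv : K / (4 * N + D) ≤ 4 * N * y + D := by
    rw [div_le_iff₀ hF, ← huv, mul_comm]
    exact mul_le_mul_of_nonneg_left hule hvpos.le
  have h := add_le_of_le_of_mul_eq hLpos hu hv huv
  have hKL : K / (K / (4 * N + D)) = 4 * N + D := by
    field_simp
  rw [hKL] at h
  -- h : (4Nx + D) + (4Ny + D) ≤ K/(4N+D) + (4N + D) ; multiply by (4N + D)
  have h2 : (4 * N * (x + y) + 2 * D) * (4 * N + D) ≤ K + (4 * N + D) * (4 * N + D) := by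
    have := mul_le_mul_of_nonneg_right h hF.le
    have e1 : (4 * N * x + D + (4 * N * y + D)) * (4 * N + D) = (4 * N * (x + y) + 2 * D) * (4 * N + D) := by ring
    have e2 : (K / (4 * N + D) + (4 * N + D)) * (4 * N + D) = K + (4 * N + D) * (4 * N + D) := by
      field_simp
    rwa [e1, e2] at this
  have hKexp : K = N * cA Δ ε + D ^ 2 := by rw [hKdef, fsK]
  rw [hKexp] at h2
  have h3 : N * (4 * (x + y) * (4 * N + D)) ≤ N * (cA Δ ε + 16 * N) := by nlinarith
  have h4 : 4 * (x + y) * (4 * N + D) ≤ cA Δ ε + 16 * N := le_of_mul_le_mul_left h3 hN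
  have hF' : 0 < 16 * N + 4 * D := by positivity
  rw [← sub_le_iff_le_add', le_div_iff₀ hF']
  have e3 : (x + y - 1) * (16 * N + 4 * D) = 4 * (x + y) * (4 * N + D) - (16 * N + 4 * D) := by ring
  rw [e3]
  linarith


/-! ## §2 The scale along a contour: the energy denominator is affine in `s = x + y` -/

/-- Constant coefficient of `∂_ε charCubic` along the contour at energy `ε`:
`dcharA = cA′ − fsN′·cA/fsN`. [folklore] -/
def dcharA (Δ tpd tpp c ε : ℝ) : ℝ := dcA Δ ε - dfsN tpp c * cA Δ ε / fsN tpd tpp c ε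

/-- Slope of `∂_ε charCubic` in `s = x + y` along the contour at energy `ε`:
`dcharB = −4fsD′ + 4fsD·fsN′/fsN`. [folklore] -/
def dcharB (Δ tpd tpp c ε : ℝ) : ℝ := -4 * dfsD Δ tpd c ε + 4 * fsD Δ tpd c ε * dfsN tpp c / fsN tpd tpp c ε

/-- ON THE CONTOUR `∂_ε charCubic(k) = dcharA + dcharB·(x + y)` (restatement of
`EmeryFermiSurfaceShapeBox.dcharCubic_on_contour` with named coefficients). [cite: AndersenEtAl1995, §6] -/
theorem dcharCubic_eq_affine {Δ tpd tpp c x y ε : ℝ} (hN : fsN tpd tpp c ε ≠ 0)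
    (hP : charCubic Δ tpd tpp c x y ε = 0) :
    dcharCubic Δ tpd tpp c x y ε = dcharA Δ tpd tpp c ε + dcharB Δ tpd tpp c ε * (x + y) := by
  rw [dcharCubic_on_contour Δ tpd tpp c x y ε hN hP, dcharA, dcharB]

/-- THE ONE-BAND-FORM CONTENT OF THE FERMI VELOCITY, EXACTLY: between two points `k, k′` of the same contour the
energy denominator (inverse velocity scale) differs by `dcharB·((x + y) − (x′ + y′))` and by nothing else. [folklore] -/
theorem dcharCubic_sub_eq {Δ tpd tpp c x y x' y' ε : ℝ} (hN : fsN tpd tpp c ε ≠ 0)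
    (hP : charCubic Δ tpd tpp c x y ε = 0) (hP' : charCubic Δ tpd tpp c x' y' ε = 0) :
    dcharCubic Δ tpd tpp c x y ε - dcharCubic Δ tpd tpp c x' y' ε =
      dcharB Δ tpd tpp c ε * ((x + y) - (x' + y')) := by
  rw [dcharCubic_eq_affine hN hP, dcharCubic_eq_affine hN hP']
  ring

/-- On the zone contour, with `s = x + y ∈ [σlo, σhi]`, the energy denominator lies between its affine values at
`σlo` and `σhi`. [folklore] -/
theorem dcharCubic_mem_Icc_of_sum_mem {Δ tpd tpp c x y ε σlo σhi : ℝ} (hN : fsN tpd tpp c ε ≠ 0)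
    (hP : charCubic Δ tpd tpp c x y ε = 0) (hs : x + y ∈ Set.Icc σlo σhi) :
    dcharCubic Δ tpd tpp c x y ε ∈ Set.Icc
      (min (dcharA Δ tpd tpp c ε + dcharB Δ tpd tpp c ε * σlo) (dcharA Δ tpd tpp c ε + dcharB Δ tpd tpp c ε * σhi))
      (max (dcharA Δ tpd tpp c ε + dcharB Δ tpd tpp c ε * σlo) (dcharA Δ tpd tpp c ε + dcharB Δ tpd tpp c ε * σhi)) := by
  rw [dcharCubic_eq_affine hN hP]
  have hle : σlo ≤ σhi := hs.1.trans hs.2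
  have hs' : x + y ∈ Set.uIcc σlo σhi := by rw [Set.uIcc_of_le hle]; exact hs
  exact affine_mem_uIcc _ _ _ _ _ hs'

end Summit.Ventures.CertifiedManyBodySolver.Downfold.Emery
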